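import Literature.Geometry.Lorentzian.KerrConvergence

/-!
# Route EIHFluxBalance — `InertialRecession`: late-time charts restricted to smaller domains and later times

Helper file for the crux `stmt-FinalStateConjecture-10166`
(`Summit.FinalStateConjecture.FinalStateConjecture.Theses.EIHFluxBalance.InertialRecession`).

The crux hypothesis provides ONE lab chart `Φ : U → M` which is an open embedding of the late
region `{x⁰ > τ₀}` of its reference background; every chart of the sought `FinalStateDecomposition`
that is a restriction of `Φ` (the flat chart on a hole-following domain `U₀ ≤ U`, started at a
later time `τ₁ ≥ τ₀`) inherits smoothness and the open-embedding property. This file records that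
transfer for a general reference background whose time function is lab time
(`isOpenEmbedding_restrict_lateRegion_of_le`, `contMDiff_comp_inclusion`), generalising
`Literature.Geometry.Lorentzian.Spacetime.isLateChart_backgroundOn_comp_inclusion` (Kerr, same
time) — pure topology of open subsets of `E4`.
-/

noncomputable section

open Literature.Geometry.Lorentzian Set Filter Function TopologicalSpace Topology
open scoped Manifold ContDiff

namespace Summit.FinalStateConjecture.FinalStateConjecture.Theorems

/-- Smoothness passes to the restriction of a chart map along an inclusion of open subsets of `E4`
(`contMDiff_inclusion`). [folklore] -/
theorem contMDiff_comp_inclusion {M : Type*} [TopologicalSpace M] [ChartedSpace (EuclideanSpace ℝ (Fin 4)) M]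
    {U₀ U : Opens E4} (h : U₀ ≤ U) {Φ : U → M} {n : WithTop ℕ∞}
    (hΦ : ContMDiff 𝓘(ℝ, E4) (𝓡 4) n Φ) :
    ContMDiff 𝓘(ℝ, E4) (𝓡 4) n (Φ ∘ Opens.inclusion h) :=
  hΦ.comp (contMDiff_inclusion h)

/-- **Open embeddings of late regions restrict to smaller domains and later times.** Let `B` be a
reference background with lab time `B.time = x⁰`, `Φ : B.domain → M` an open embedding of the late
region `{x⁰ > τ₀}`, `U₀ ≤ B.domain` open and `τ₀ ≤ τ₁`. Then `Φ ∘ inclusion` is an open embedding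
of the late region `{x⁰ > τ₁}` of the Minkowski background on `U₀` (the inclusion of the smaller
late region into the larger is an open embedding, `IsOpenEmbedding.of_comp` along the two open
embeddings into `E4`). DHRT arXiv:2104.08222, §1 (late regions). [folklore] -/
theorem isOpenEmbedding_restrict_lateRegion_of_le' {M : Type*} [TopologicalSpace M]
    (B : ModelBackground) (htime : ∀ x, B.time x = x 0) {Φ : B.domain → M} {τ₀ τ₁ : ℝ}
    (hΦ : IsOpenEmbedding ((B.lateRegion τ₀).restrict Φ)) {U₀ : Opens E4}
    (h : (Minkowski.backgroundOn U₀).domain ≤ B.domain) (hτ : τ₀ ≤ τ₁) :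
    IsOpenEmbedding (((Minkowski.backgroundOn U₀).lateRegion τ₁).restrict
      (Φ ∘ Opens.inclusion h)) := by
  have hc0 : Continuous fun y : E4 ↦ y 0 := PiLp.continuous_apply 2 _ 0
  have hLB : IsOpen (B.lateRegion τ₀) := by
    have : B.lateRegion τ₀ = {x | τ₀ < x.1 0} := by
      ext x
      rw [ModelBackground.mem_lateRegion, htime]
      rfl
    rw [this]
    exact isOpen_lt continuous_const (hc0.comp continuous_subtype_val)
  have hLU : IsOpen ((Minkowski.backgroundOn U₀).lateRegion τ₁) :=
    isOpen_lt continuous_const (hc0.comp continuous_subtype_val)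
  have hsub : ∀ x : (Minkowski.backgroundOn U₀).lateRegion τ₁, Opens.inclusion h x.1 ∈ B.lateRegion τ₀ := by
    intro x
    rw [ModelBackground.mem_lateRegion, htime]
    have hx : τ₁ < x.1.1 0 := x.2
    exact lt_of_le_of_lt hτ hx
  let j : (Minkowski.backgroundOn U₀).lateRegion τ₁ → B.lateRegion τ₀ :=
    fun x ↦ ⟨Opens.inclusion h x.1, hsub x⟩
  have hgB : IsOpenEmbedding (fun x : B.lateRegion τ₀ ↦ (x.1.1 : E4)) :=
    B.domain.2.isOpenEmbedding_subtypeVal.comp hLB.isOpenEmbedding_subtypeVal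
  have hgU : IsOpenEmbedding (fun x : (Minkowski.backgroundOn U₀).lateRegion τ₁ ↦ (x.1.1 : E4)) :=
    (Minkowski.backgroundOn U₀).domain.2.isOpenEmbedding_subtypeVal.comp hLU.isOpenEmbedding_subtypeVal
  have hj : IsOpenEmbedding j := IsOpenEmbedding.of_comp j hgB hgU
  exact hΦ.comp hj

/-- The image of the smaller, later late region is contained in the image of the original one
(bookkeeping for the `image_subset` clause of `IsLateChart` and for exhaustion transfers). [folklore] -/
theorem image_restrict_lateRegion_subset {M : Type*} (B : ModelBackground)
    (htime : ∀ x, B.time x = x 0) (Φ : B.domain → M) {τ₀ τ₁ : ℝ} {U₀ : Opens E4}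
    (h : (Minkowski.backgroundOn U₀).domain ≤ B.domain) (hτ : τ₀ ≤ τ₁) :
    (Φ ∘ Opens.inclusion h) '' (Minkowski.backgroundOn U₀).lateRegion τ₁ ⊆ Φ '' B.lateRegion τ₀ := by
  rintro _ ⟨x, hx, rfl⟩
  refine ⟨Opens.inclusion h x, ?_, rfl⟩
  rw [ModelBackground.mem_lateRegion, htime]
  have hx' : τ₁ < x.1 0 := hx
  exact lt_of_le_of_lt hτ hx'

/-- Registered sub-goal form (stub `isOpenEmbedding_restrict_lateRegion_of_le` of the crux item) of
`isOpenEmbedding_restrict_lateRegion_of_le'` (carriers in `Type`). [folklore] -/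
theorem isOpenEmbedding_restrict_lateRegion_of_le : open Literature.Geometry.Lorentzian Topology TopologicalSpace in ∀ {M : Type} [TopologicalSpace M] (B : ModelBackground), (∀ x, B.time x = x 0) → ∀ {Φ : B.domain → M} {τ₀ τ₁ : ℝ}, IsOpenEmbedding ((B.lateRegion τ₀).restrict Φ) → ∀ {U₀ : Opens E4} (h : (Minkowski.backgroundOn U₀).domain ≤ B.domain), τ₀ ≤ τ₁ → IsOpenEmbedding (((Minkowski.backgroundOn U₀).lateRegion τ₁).restrict (Φ ∘ Opens.inclusion h)) :=
  fun B htime _ _ _ hΦ _ h hτ ↦ isOpenEmbedding_restrict_lateRegion_of_le' B htime hΦ h hτ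

end Summit.FinalStateConjecture.FinalStateConjecture.Theorems

end
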